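import Literature.RepresentationTheory.Kovacevic2021.SU21ModulesFromKTypes
import Summits.HodgeConjecture.HodgeConjecture.Theorems.F0P3bKTypeIntegration
import Summits.HodgeConjecture.HodgeConjecture.Theorems.F0P3bU21Coordinates
import HarnessLib

/-!
# FLOOR-0 P3b «ENGINE local packets», line `F0_LocalAPackets` — STUB W4 CLOSED: the LADDER VALUE MAP of
# Kovačević's `Z(3) = ladderPlus` at the vertex `K`-type `V_{2,3}` (sign `δ = 1`)

Cell hodgecm-mathlib (D-0151), FLOOR 0, crux item H413 = stmt-HodgeConjecture-24833; sub-line `Cruxes/H413/Lines/F0_LocalAPackets.lean`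
edition 4K (F0P3b-plan (g6) 2026-08-31T04:12:44Z «W-STUBS CONCRETE»; draft `F0/P3b/F0_LocalAPackets.ed4K.draft.F0P3b-plan-g6.lean` :223,
paste-cert `F0/P3b/PASTECERT-ed4K.F0P3b-plan-g6.lean`), registered stub **W4** `stub_W4ValueMap : StubW4ValueMap`, brief B3.  PROOF
lane (theorems only: no `def`, no `sorry`, no instance declaration, no notation, no named fact); author B-p08 (g17).  Per the cell's
stub-closer protocol (director s347) the Lines module is NOT imported: the TYPE of `stubW4ValueMap_holds` (§5) is the body of
`…Cruxes.H413.F0LocalAPackets.StubW4ValueMap` (ed. 4K :223–225) TOKEN FOR TOKEN, and the by-name fold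
`theorem stub_W4ValueMap : StubW4ValueMap := F0P3bStubW4ValueMap.stubW4ValueMap_holds` goes into the line at its next edition.

Content.  `V = ladderPlus.V` (Kovačević's `Z(3)`: `K`-types `V_{n,3n−3}`, `n ≥ 2`; ★ `SU21ModulesFromKTypes`), `ρ𝔤 = kovLie ladderPlus.ρ`
(★ (w3g) `F0P3bU21Restriction`), `ρK = kTypeRep ladderPlus.S` (★ A1 `F0P3bKTypeIntegration`).  The value map is
**`φ(X) = X₀₂ · u¹ − X₁₂ · u²`**, `u^k = vec 2 3 k` the basis of the VERTEX `K`-type `V_{2,3}`, `X₀₂, X₁₂` the `𝔭⁺`-column of `X ∈ 𝔲(2,1)`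
(★ `upqEntry`): the `K`-equivariant identification `𝔭⁺ ≅ V_{2,3}` (`e₁ ↦ u¹`, `e₂ ↦ −u²`, forced by Kovačević's normalisation
`X_α u² = −u¹`, `Y_α u¹ = −u²`).  The six clauses of ★ `IsLadderValueMap` (defs leaf) with `δ = 1`: (1) `φ(X_{E₀₀… }) = u¹ ≠ 0`;
(2) `φ|𝔨 = 0` (★ `upq_mem_kInLie_iff_blocks`); (3) `K`-EQUIVARIANCE — on the vertex block `ρK(k)` is the matrix
`kTypeMat 2 3 k = diag(1,−1) · ū k₁₁ · diag(1,−1)` (`a = 0`, `b = −1`, `Sym¹ = id`: §2b `kTypeMat_vertex`, `symPowerMat_deg_one`, `u⁻¹ = ū`),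
and `(Ad k X)₁₂ = k₁₁ X₁₂ ū` (★ `coe_eq_fromBlocks_upqKBlock`, ★ `RealMatrixGroup.Ad_apply_coe`) — a 2×2 identity; (4) `𝔨`-EQUIVARIANCE
— `(⁅W, X⁆)_{a2} = (W₁₁ X₁₂)_a − X_{a2} W₂₂` against ★ (w4g) `kovLie_of_mem_kInLie` and the vertex table (§2); (5) `z₀`-weight `i`:
★ (w4g) `kovLie_upqZ0` = `i (ρE₀₀ + ρE₁₁)` acts as `i` on `V_{2,3}` (so `δ = 1`: `J⁺`); (6) `𝔭⁻`-NULLITY: by ★ (w4g)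
`kovLie_upqPBasis`∕`kovLie_lie_upqZ0_upqPBasis`, `ρ𝔤(x_s) + i ρ𝔤⁅z₀, x_s⁆ = 2 ē_k · ρ E_{2a}`, and `E₂₀ = Y_{α+β}`, `E₂₁ = Y_β` KILL `V_{2,3}`
(targets `(3,0)`, `(1,0) ∉ S`: Kovačević's ★ `Yab_vec`∕`Yb_vec` + `vec_of_not_mem`).  [BorelWallach2000, II §4.1–4.2; Kovacevic2021, §3–§4, §6].

HC_CM is proved only modulo the 7 printed citations until rung 0 closes; this closes ONE stub (W4) of ONE floor-0 sub-line; the line's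
T3a₁ is the composition of W1–W4.

## References
* [Kovacevic2021] D. Kovačević, *the `(𝔤, K)`-modules of `SU(2,1)` from `K`-types* (2021) — §3 Def. 1, Thm 1 (the `u`-basis and the
  eight operators), §4 (`Z(s)`), §6.
* [BorelWallach2000] A. Borel, N. Wallach, *Continuous Cohomology, Discrete Subgroups, and Representations of Reductive Groups*, 2nd ed.,
  AMS 2000 — II §4.1–4.2 (`z₀`, `𝔭^±`, the bigrading), VI Thm 4.11 (9) (`J_{1,0}`).
-/

set_option autoImplicit false
set_option linter.dupNamespace false

noncomputable section

namespace Summit.HodgeConjecture.HodgeConjecture.Cruxes.H413.F0P3bStubW4ValueMap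

open Literature.NumberTheory.Automorphic
open Literature.RepresentationTheory.BorelWallach2000
open Literature.RepresentationTheory.KonnoKonno2007 Literature.RepresentationTheory.KonnoKonno2007.RealDualPair
open Literature.RepresentationTheory.KonnoKonno2007.RealDualPair.UForm
open Literature.RepresentationTheory.Kovacevic2021 Literature.RepresentationTheory.Kovacevic2021.SU21Datum
open Summit.HodgeConjecture.HodgeConjecture.Cruxes.H413.F0P3bKTypeIntegration
open Summit.HodgeConjecture.HodgeConjecture.Cruxes.H413.F0P3bKTypeCalculus
open Summit.HodgeConjecture.HodgeConjecture.Cruxes.H413.F0P3bLocalAPacketsDefs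
open Summit.HodgeConjecture.HodgeConjecture.Cruxes.H413.F0P3bU21Restriction
open Summit.HodgeConjecture.HodgeConjecture.Cruxes.H413.F0P3bU21Coordinates
open scoped ComplexConjugate Matrix

attribute [local instance 100] LieRing.ofAssociativeRing

/-! ## §1 The vertex `K`-type `V_{2,3}` of `Z(3) = ladderPlus`: membership and the vanishing neighbours -/

/-- `(2, 3)` is a `K`-type of `Z(3)` — the vertex `V_{2,3}`. [cite: Kovacevic2021, §4] -/
theorem vertex_mem : ((2 : ℤ), (3 : ℤ)) ∈ ladderPlus.S := by
  rw [mem_ladderPlus]; omega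

/-- `(3, 0)` is NOT a `K`-type of `Z(3)` (target of the `B`-arrow out of the vertex). [cite: Kovacevic2021, §4] -/
theorem not_mem_three_zero : ((3 : ℤ), (0 : ℤ)) ∉ ladderPlus.S := by
  rw [mem_ladderPlus]; omega

/-- `(1, 0)` is NOT a `K`-type of `Z(3)` (target of the `D`-arrow out of the vertex). [cite: Kovacevic2021, §4] -/
theorem not_mem_one_zero : ((1 : ℤ), (0 : ℤ)) ∉ ladderPlus.S := by
  rw [mem_ladderPlus]; omega

/-! ## §2 The action of the nine matrix units on the vertex vectors `u¹ = vec 2 3 1`, `u² = vec 2 3 2` -/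

/-- `ladderPlus.ρ M = ladderPlus.ρfun M` (definitional). [cite: Kovacevic2021, §3 Thm 1] -/
theorem rho_eq_rhofun (M : Matrix (Fin 3) (Fin 3) ℂ) : ladderPlus.ρ M = ladderPlus.ρfun M := rfl

/-- `E₂₀ = Y_{α+β}` kills the vertex `K`-type (`B`- and `D`-targets `(3,0)`, `(1,0) ∉ S`). [cite: Kovacevic2021, §3 Thm 1] -/
theorem E20_vec (k : ℤ) (hk : 1 ≤ k) : ladderPlus.ρ (Matrix.single 2 0 1) (ladderPlus.vec 2 3 k) = 0 := by
  rw [rho_eq_rhofun, show (Matrix.single 2 0 (1 : ℂ)) = E 2 0 from rfl, ρfun_E]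
  show ladderPlus.Yab (ladderPlus.vec 2 3 k) = 0
  rw [Yab_vec 2 3 hk, vec_of_not_mem _ (by norm_num [mem_ladderPlus] : ((2 : ℤ) + 1, (3 : ℤ) - 3) ∉ ladderPlus.S),
    vec_of_not_mem _ (by norm_num [mem_ladderPlus] : ((2 : ℤ) - 1, (3 : ℤ) - 3) ∉ ladderPlus.S), smul_zero, smul_zero,
    add_zero]

/-- `E₂₁ = Y_β` kills the vertex `K`-type. [cite: Kovacevic2021, §3 Thm 1] -/
theorem E21_vec (k : ℤ) : ladderPlus.ρ (Matrix.single 2 1 1) (ladderPlus.vec 2 3 k) = 0 := by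
  rw [rho_eq_rhofun, show (Matrix.single 2 1 (1 : ℂ)) = E 2 1 from rfl, ρfun_E]
  show ladderPlus.Yb (ladderPlus.vec 2 3 k) = 0
  rw [Yb_vec 2 3 k, vec_of_not_mem _ (by norm_num [mem_ladderPlus] : ((2 : ℤ) + 1, (3 : ℤ) - 3) ∉ ladderPlus.S),
    vec_of_not_mem _ (by norm_num [mem_ladderPlus] : ((2 : ℤ) - 1, (3 : ℤ) - 3) ∉ ladderPlus.S), smul_zero, smul_zero,
    add_zero]

/-- `E₀₀ u¹ = u¹` (`E₀₀ ↦ ⅔H_α + ⅓H_β`). [cite: Kovacevic2021, §3 Def. 1] -/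
theorem E00_vec_one : ladderPlus.ρ (Matrix.single 0 0 1) (ladderPlus.vec 2 3 1) = ladderPlus.vec 2 3 1 := by
  rw [rho_eq_rhofun, show (Matrix.single 0 0 (1 : ℂ)) = E 0 0 from rfl, ρfun_E]
  show ((2 / 3 : ℂ) • ladderPlus.Ha + (1 / 3 : ℂ) • ladderPlus.Hb) (ladderPlus.vec 2 3 1) = _
  rw [LinearMap.add_apply, LinearMap.smul_apply, LinearMap.smul_apply, Ha_vec, Hb_vec, smul_smul, smul_smul, ← add_smul]
  conv_rhs => rw [← one_smul ℂ (ladderPlus.vec 2 3 1)]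
  congr 1
  push_cast
  ring

/-- `E₀₀ u² = 0`. [cite: Kovacevic2021, §3 Def. 1] -/
theorem E00_vec_two : ladderPlus.ρ (Matrix.single 0 0 1) (ladderPlus.vec 2 3 2) = 0 := by
  rw [rho_eq_rhofun, show (Matrix.single 0 0 (1 : ℂ)) = E 0 0 from rfl, ρfun_E]
  show ((2 / 3 : ℂ) • ladderPlus.Ha + (1 / 3 : ℂ) • ladderPlus.Hb) (ladderPlus.vec 2 3 2) = _
  rw [LinearMap.add_apply, LinearMap.smul_apply, LinearMap.smul_apply, Ha_vec, Hb_vec, smul_smul, smul_smul, ← add_smul]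
  conv_rhs => rw [← zero_smul ℂ (ladderPlus.vec 2 3 2)]
  congr 1
  push_cast
  ring

/-- `E₁₁ u¹ = 0` (`E₁₁ ↦ −⅓H_α + ⅓H_β`). [cite: Kovacevic2021, §3 Def. 1] -/
theorem E11_vec_one : ladderPlus.ρ (Matrix.single 1 1 1) (ladderPlus.vec 2 3 1) = 0 := by
  rw [rho_eq_rhofun, show (Matrix.single 1 1 (1 : ℂ)) = E 1 1 from rfl, ρfun_E]
  show ((-1 / 3 : ℂ) • ladderPlus.Ha + (1 / 3 : ℂ) • ladderPlus.Hb) (ladderPlus.vec 2 3 1) = _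
  rw [LinearMap.add_apply, LinearMap.smul_apply, LinearMap.smul_apply, Ha_vec, Hb_vec, smul_smul, smul_smul, ← add_smul]
  conv_rhs => rw [← zero_smul ℂ (ladderPlus.vec 2 3 1)]
  congr 1
  push_cast
  ring

/-- `E₁₁ u² = u²`. [cite: Kovacevic2021, §3 Def. 1] -/
theorem E11_vec_two : ladderPlus.ρ (Matrix.single 1 1 1) (ladderPlus.vec 2 3 2) = ladderPlus.vec 2 3 2 := by
  rw [rho_eq_rhofun, show (Matrix.single 1 1 (1 : ℂ)) = E 1 1 from rfl, ρfun_E]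
  show ((-1 / 3 : ℂ) • ladderPlus.Ha + (1 / 3 : ℂ) • ladderPlus.Hb) (ladderPlus.vec 2 3 2) = _
  rw [LinearMap.add_apply, LinearMap.smul_apply, LinearMap.smul_apply, Ha_vec, Hb_vec, smul_smul, smul_smul, ← add_smul]
  conv_rhs => rw [← one_smul ℂ (ladderPlus.vec 2 3 2)]
  congr 1
  push_cast
  ring

/-- `E₂₂ u^k = −u^k` (`E₂₂ ↦ −⅓H_α − ⅔H_β`; the centre `E₀₀ + E₁₁ + E₂₂` acts by `0`). [cite: Kovacevic2021, §3 Def. 1] -/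
theorem E22_vec (k : ℤ) : ladderPlus.ρ (Matrix.single 2 2 1) (ladderPlus.vec 2 3 k) = -ladderPlus.vec 2 3 k := by
  rw [rho_eq_rhofun, show (Matrix.single 2 2 (1 : ℂ)) = E 2 2 from rfl, ρfun_E]
  show ((-1 / 3 : ℂ) • ladderPlus.Ha + (-2 / 3 : ℂ) • ladderPlus.Hb) (ladderPlus.vec 2 3 k) = _
  rw [LinearMap.add_apply, LinearMap.smul_apply, LinearMap.smul_apply, Ha_vec, Hb_vec, smul_smul, smul_smul, ← add_smul,
    ← neg_one_smul ℂ (ladderPlus.vec 2 3 k)]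
  congr 1
  push_cast
  ring

/-- `E₀₁ u¹ = X_α u¹ = 0`. [cite: Kovacevic2021, §3 Def. 1] -/
theorem E01_vec_one : ladderPlus.ρ (Matrix.single 0 1 1) (ladderPlus.vec 2 3 1) = 0 := by
  rw [rho_eq_rhofun, show (Matrix.single 0 1 (1 : ℂ)) = E 0 1 from rfl, ρfun_E]
  show ladderPlus.Xa (ladderPlus.vec 2 3 1) = 0
  rw [Xa_vec]
  push_cast
  simp

/-- `E₀₁ u² = X_α u² = −u¹`. [cite: Kovacevic2021, §3 Def. 1] -/
theorem E01_vec_two : ladderPlus.ρ (Matrix.single 0 1 1) (ladderPlus.vec 2 3 2) = -ladderPlus.vec 2 3 1 := by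
  rw [rho_eq_rhofun, show (Matrix.single 0 1 (1 : ℂ)) = E 0 1 from rfl, ρfun_E]
  show ladderPlus.Xa (ladderPlus.vec 2 3 2) = _
  rw [Xa_vec, show ((2 : ℤ) - 1 : ℤ) = 1 by norm_num, ← neg_one_smul ℂ (ladderPlus.vec 2 3 1)]
  congr 1
  push_cast
  ring

/-- `E₁₀ u¹ = Y_α u¹ = −u²`. [cite: Kovacevic2021, §3 Def. 1] -/
theorem E10_vec_one : ladderPlus.ρ (Matrix.single 1 0 1) (ladderPlus.vec 2 3 1) = -ladderPlus.vec 2 3 2 := by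
  rw [rho_eq_rhofun, show (Matrix.single 1 0 (1 : ℂ)) = E 1 0 from rfl, ρfun_E]
  show ladderPlus.Ya (ladderPlus.vec 2 3 1) = _
  rw [Ya_vec 2 3 le_rfl]
  norm_num

/-- `E₁₀ u² = Y_α u² = −u³ = 0`. [cite: Kovacevic2021, §3 Def. 1] -/
theorem E10_vec_two : ladderPlus.ρ (Matrix.single 1 0 1) (ladderPlus.vec 2 3 2) = 0 := by
  rw [rho_eq_rhofun, show (Matrix.single 1 0 (1 : ℂ)) = E 1 0 from rfl, ρfun_E]
  show ladderPlus.Ya (ladderPlus.vec 2 3 2) = 0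
  rw [Ya_vec 2 3 (by norm_num), show ((2 : ℤ) + 1 : ℤ) = 3 by norm_num, vec_of_lt 3 (by norm_num : (2 : ℤ) < 3), neg_zero]

/-! ## §2b `Sym¹(g) = g` and the vertex `K`-matrix -/

open MvPolynomial Literature.RepresentationTheory.AlgebraicGroups.SL2Sym in
/-- The degree-one exponent `X₀^{1−i} X₁^{i}` is `single i 1`. [folklore] -/
theorem expo_one_eq (i : Fin 2) : expo 1 (i : ℕ) = Finsupp.single i 1 := by
  fin_cases i <;> simp [expo]

open MvPolynomial Literature.RepresentationTheory.AlgebraicGroups.SL2Sym in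
/-- The degree-one monomial `X₀^{1−j} X₁^{j}` is the variable `X_j`. [folklore] -/
theorem mono_one_eq (j : Fin 2) : (mono 1 (j : ℕ) : MvPolynomial (Fin 2) ℂ) = X j := by
  rw [mono, expo_one_eq, X]

open MvPolynomial Literature.RepresentationTheory.AlgebraicGroups.SL2Sym in
/-- `Sym¹(g) = g` entrywise (the monomial basis `X₀, X₁` of degree-one forms IS the standard basis). [folklore] -/
theorem symPowerMat_deg_one (g : Matrix (Fin 2) (Fin 2) ℂ) (i j : Fin 2) : symPowerMat 1 g i j = g i j := by
  rw [symPowerMat, Matrix.of_apply]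
  rw [show (mono 1 (j : ℕ) : MvPolynomial (Fin 2) ℂ) = X j from mono_one_eq j, symAct_X, expo_one_eq,
    MvPolynomial.coeff_sum]
  simp only [MvPolynomial.coeff_C_mul, MvPolynomial.coeff_X, Finsupp.single_left_inj one_ne_zero]
  rw [Fin.sum_univ_two]
  fin_cases i <;> simp

/-- The `U(1)`-entry `u = k₂₂` of `k ∈ K = U(2) × U(1)` satisfies `u · ū = 1`. [cite: BorelWallach2000, VI 4.7] -/
theorem kBlock₂_mul_conj (k : (uFormGroup (Fin 2) (Fin 1)).maximalCompact) :
    ((upqKBlock₂ k : Matrix.unitaryGroup (Fin 1) ℂ) : Matrix (Fin 1) (Fin 1) ℂ) 0 0 *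
        conj (((upqKBlock₂ k : Matrix.unitaryGroup (Fin 1) ℂ) : Matrix (Fin 1) (Fin 1) ℂ) 0 0) = 1 := by
  have h := Matrix.mem_unitaryGroup_iff.1 (upqKBlock₂ k).2
  have h00 := congrFun (congrFun h 0) 0
  rw [Matrix.mul_apply, Fin.sum_univ_one, Matrix.one_apply_eq, Matrix.star_apply, RCLike.star_def] at h00
  exact h00

/-- Hence `u⁻¹ = ū`. [cite: BorelWallach2000, VI 4.7] -/
theorem kBlock₂_inv (k : (uFormGroup (Fin 2) (Fin 1)).maximalCompact) :
    (((upqKBlock₂ k : Matrix.unitaryGroup (Fin 1) ℂ) : Matrix (Fin 1) (Fin 1) ℂ) 0 0)⁻¹ =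
      conj (((upqKBlock₂ k : Matrix.unitaryGroup (Fin 1) ℂ) : Matrix (Fin 1) (Fin 1) ℂ) 0 0) :=
  inv_eq_of_mul_eq_one_right (kBlock₂_mul_conj k)

/-- **The vertex `K`-matrix**: `kTypeMat 2 3 k l i = (cnorm 1 i ∕ cnorm 1 l) · ū · (k₁₁) l i` (`a = (3−6+3)∕6 = 0`, `b = −3∕3 = −1`, `Sym¹ = id`): `ρK(k)|V_{2,3} = diag(1,−1) · ū k₁₁ · diag(1,−1)` in the `u`-basis. [cite: BorelWallach2000, VI §4 4.7–4.8] -/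
theorem kTypeMat_vertex (k : (uFormGroup (Fin 2) (Fin 1)).maximalCompact) (l i : Fin 2) :
    kTypeMat 2 3 k l i = cnorm 1 i / cnorm 1 l *
      (conj (((upqKBlock₂ k : Matrix.unitaryGroup (Fin 1) ℂ) : Matrix (Fin 1) (Fin 1) ℂ) 0 0) *
        ((upqKBlock₁ k : Matrix.unitaryGroup (Fin 2) ℂ) : Matrix (Fin 2) (Fin 2) ℂ) l i) := by
  rw [kTypeMat_apply, upqKTypeCoeff_apply]
  erw [symPowerMat_deg_one]
  rw [show ((3 : ℤ) - 3 * 2 + 3) / 6 = 0 by norm_num, show (-((3 : ℤ) / 3)) = -1 by norm_num, zpow_zero, one_mul,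
    zpow_neg_one, kBlock₂_inv]
  rfl

/-- A1's datum-free `kvec ladderPlus.S` IS Kovačević's `ladderPlus.vec` (same body, `rfl`). [cite: Kovacevic2021, §3 Def. 1] -/
theorem kvec_eq_vec (n m j : ℤ) : (kvec ladderPlus.S n m j : KIdx ladderPlus.S →₀ ℂ) = ladderPlus.vec n m j := rfl

/-! ## §3 The value map `φ(X) = X₀₂ · u¹ − X₁₂ · u²` -/

/-- **The value map `φ(X) = X₀₂ · u¹ − X₁₂ · u²`** (as a closed real-linear term over ★ `upqEntry`), unfolded. [cite: BorelWallach2000, II §4.2] -/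
theorem phi_apply (X : G21.lie) :
    ((upqEntry ((0 : Fin 2), (0 : Fin 1))).smulRight (ladderPlus.vec 2 3 1) -
        (upqEntry ((1 : Fin 2), (0 : Fin 1))).smulRight (ladderPlus.vec 2 3 2) : G21.lie →ₗ[ℝ] ladderPlus.V) X =
      (X : Matrix (Fin 2 ⊕ Fin 1) (Fin 2 ⊕ Fin 1) ℂ) (Sum.inl 0) (Sum.inr 0) • ladderPlus.vec 2 3 1 -
        (X : Matrix (Fin 2 ⊕ Fin 1) (Fin 2 ⊕ Fin 1) ℂ) (Sum.inl 1) (Sum.inr 0) • ladderPlus.vec 2 3 2 := by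
  rfl

/-- `𝔭⁻ = span{E₂₀, E₂₁}` kills the values of `φ` (they lie in the vertex `K`-type). [cite: Kovacevic2021, §3 Thm 1] -/
theorem E2a_phi (a : Fin 2) (X : G21.lie) :
    ladderPlus.ρ (Matrix.single 2 (Fin.castSucc a) 1)
      ((X : Matrix (Fin 2 ⊕ Fin 1) (Fin 2 ⊕ Fin 1) ℂ) (Sum.inl 0) (Sum.inr 0) • ladderPlus.vec 2 3 1 -
        (X : Matrix (Fin 2 ⊕ Fin 1) (Fin 2 ⊕ Fin 1) ℂ) (Sum.inl 1) (Sum.inr 0) • ladderPlus.vec 2 3 2) = 0 := by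
  fin_cases a
  · show ladderPlus.ρ (Matrix.single 2 0 1) _ = 0
    rw [map_sub, map_smul, map_smul, E20_vec 1 le_rfl, E20_vec 2 (by norm_num), smul_zero, smul_zero, sub_zero]
  · show ladderPlus.ρ (Matrix.single 2 1 1) _ = 0
    rw [map_sub, map_smul, map_smul, E21_vec, E21_vec, smul_zero, smul_zero, sub_zero]

/-! ## §4 The closer -/

/-- **STUB W4 `StubW4ValueMap` CLOSED** — the body of `…Cruxes.H413.F0LocalAPackets.StubW4ValueMap` (ed. 4K :223–225) TOKEN FOR TOKEN as the type: a ladder value map of sign `δ = 1` for `(kTypeRep ladderPlus.S, kovLie ladderPlus.ρ)`, namely `φ(X) = X₀₂ · u¹ − X₁₂ · u²` onto the vertex `K`-type `V_{2,3}`; the six clauses of ★ `IsLadderValueMap` are (1) `φ ≠ 0`, (2) `φ|𝔨 = 0`, (3) `K`-equivariance (the 2×2 identity `kTypeMat 2 3 k · φ = φ ∘ Ad k`), (4) `𝔨`-equivariance, (5) `z₀`-weight `i`, (6) `𝔭⁻`-nullity.  The line folds `stub_W4ValueMap := stubW4ValueMap_holds` by name. [cite: BorelWallach2000, II §4.1–4.2;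 Kovacevic2021, §3–§4] -/
theorem stubW4ValueMap_holds :
    ∃ (δ : ℤ) (φ : G21.lie →ₗ[ℝ] ladderPlus.V), (δ = 1 ∨ δ = -1) ∧
      IsLadderValueMap (kTypeRep ladderPlus.S) (kovLie ladderPlus.ρ) δ φ := by
  refine ⟨1, (upqEntry ((0 : Fin 2), (0 : Fin 1))).smulRight (ladderPlus.vec 2 3 1) -
    (upqEntry ((1 : Fin 2), (0 : Fin 1))).smulRight (ladderPlus.vec 2 3 2), Or.inl rfl, ?_, ?_, ?_, ?_, ?_, ?_⟩
  · -- (1) `φ ≠ 0`: `φ(X_{E_(0,0)}) = u¹ ≠ 0`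
    intro h
    have h1 := LinearMap.congr_fun h (upqUnit ((0 : Fin 2), (0 : Fin 1)) 1)
    have e00 : ((upqUnit ((0 : Fin 2), (0 : Fin 1)) 1 : G21.lie) : Matrix (Fin 2 ⊕ Fin 1) (Fin 2 ⊕ Fin 1) ℂ)
        (Sum.inl 0) (Sum.inr 0) = 1 := by
      rw [coe_upqUnit, Matrix.fromBlocks_apply₁₂, Matrix.single_apply_same]
    have e10 : ((upqUnit ((0 : Fin 2), (0 : Fin 1)) 1 : G21.lie) : Matrix (Fin 2 ⊕ Fin 1) (Fin 2 ⊕ Fin 1) ℂ)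
        (Sum.inl 1) (Sum.inr 0) = 0 := by
      rw [coe_upqUnit, Matrix.fromBlocks_apply₁₂]
      exact Matrix.single_apply_of_row_ne (by decide) _ _ _
    rw [phi_apply, LinearMap.zero_apply, e00, e10, one_smul, zero_smul, sub_zero,
      vec_of_pos 2 3 1 ⟨vertex_mem, le_rfl, by norm_num⟩] at h1
    exact one_ne_zero (Finsupp.single_eq_zero.1 h1)
  · -- (2) `φ|𝔨 = 0`
    intro W hW
    have h12 := (upq_mem_kInLie_iff_blocks W).1 hW
    have h0 : (W : Matrix (Fin 2 ⊕ Fin 1) (Fin 2 ⊕ Fin 1) ℂ) (Sum.inl 0) (Sum.inr 0) = 0 := by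
      have := congrFun (congrFun h12 0) 0; rwa [Matrix.toBlocks₁₂, Matrix.of_apply, Matrix.zero_apply] at this
    have h1 : (W : Matrix (Fin 2 ⊕ Fin 1) (Fin 2 ⊕ Fin 1) ℂ) (Sum.inl 1) (Sum.inr 0) = 0 := by
      have := congrFun (congrFun h12 1) 0; rwa [Matrix.toBlocks₁₂, Matrix.of_apply, Matrix.zero_apply] at this
    rw [phi_apply, h0, h1, zero_smul, zero_smul, sub_zero]
  · -- (3) `K`-equivariance
    intro k X
    -- the `𝔭⁺`-column of `Ad k X` is `k₁₁ · (X₀₂, X₁₂)ᵀ · ū`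
    have hk := coe_eq_fromBlocks_upqKBlock k
    have hAd : ∀ a : Fin 2,
        (((uFormGroup (Fin 2) (Fin 1)).Ad (Subgroup.inclusion (uFormGroup (Fin 2) (Fin 1)).maximalCompact_le_carrier k) X :
            G21.lie) : Matrix (Fin 2 ⊕ Fin 1) (Fin 2 ⊕ Fin 1) ℂ) (Sum.inl a) (Sum.inr 0) =
          (((upqKBlock₁ k : Matrix.unitaryGroup (Fin 2) ℂ) : Matrix (Fin 2) (Fin 2) ℂ) a 0 *
                (X : Matrix (Fin 2 ⊕ Fin 1) (Fin 2 ⊕ Fin 1) ℂ) (Sum.inl 0) (Sum.inr 0) +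
              ((upqKBlock₁ k : Matrix.unitaryGroup (Fin 2) ℂ) : Matrix (Fin 2) (Fin 2) ℂ) a 1 *
                (X : Matrix (Fin 2 ⊕ Fin 1) (Fin 2 ⊕ Fin 1) ℂ) (Sum.inl 1) (Sum.inr 0)) *
            conj (((upqKBlock₂ k : Matrix.unitaryGroup (Fin 1) ℂ) : Matrix (Fin 1) (Fin 1) ℂ) 0 0) := by
      intro a
      have hkinv := coe_eq_fromBlocks_upqKBlock k⁻¹
      rw [map_inv, map_inv] at hkinv
      rw [RealMatrixGroup.Ad_apply_coe]
      change (((k : GL (Fin 2 ⊕ Fin 1) ℂ) : Matrix (Fin 2 ⊕ Fin 1) (Fin 2 ⊕ Fin 1) ℂ) *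
          (X : Matrix (Fin 2 ⊕ Fin 1) (Fin 2 ⊕ Fin 1) ℂ) *
          (((k⁻¹ : (uFormGroup (Fin 2) (Fin 1)).maximalCompact) : GL (Fin 2 ⊕ Fin 1) ℂ) :
            Matrix (Fin 2 ⊕ Fin 1) (Fin 2 ⊕ Fin 1) ℂ)) (Sum.inl a) (Sum.inr 0) = _
      rw [hk, hkinv]
      conv_lhs => rw [← Matrix.fromBlocks_toBlocks (X : Matrix (Fin 2 ⊕ Fin 1) (Fin 2 ⊕ Fin 1) ℂ)]
      rw [Matrix.fromBlocks_multiply, Matrix.fromBlocks_multiply, Matrix.fromBlocks_apply₁₂]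
      simp only [Matrix.zero_mul, Matrix.mul_zero, add_zero, zero_add, Matrix.mul_apply, Fin.sum_univ_two,
        Fin.sum_univ_one, Matrix.toBlocks₁₂, Matrix.of_apply, Matrix.UnitaryGroup.inv_apply, Matrix.star_apply,
        RCLike.star_def]
    -- the `K`-action on the vertex vectors
    have hn : (1 : ℤ) ≤ 2 := by norm_num
    have hu1 := kTypeEnd_kvec (S := ladderPlus.S) k vertex_mem hn 0
    have hu2 := kTypeEnd_kvec (S := ladderPlus.S) k vertex_mem hn 1
    erw [Fin.sum_univ_two] at hu1 hu2
    erw [kTypeMat_vertex k 0 0, kTypeMat_vertex k 1 0] at hu1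
    erw [kTypeMat_vertex k 0 1, kTypeMat_vertex k 1 1] at hu2
    simp only [kvec_eq_vec, Fin.coe_ofNat_eq_mod, cnorm] at hu1 hu2
    norm_num at hu1 hu2
    rw [phi_apply, phi_apply, hAd 0, hAd 1, kTypeRep_apply, map_sub, map_smul, map_smul]
    erw [hu1, hu2]
    simp only [coe_upqKBlock₁, coe_upqKBlock₂]
    module
  · -- (4) `𝔨`-equivariance
    intro W hW X
    have h12 := (upq_mem_kInLie_iff_blocks W).1 hW
    have hW02 : (W : Matrix (Fin 2 ⊕ Fin 1) (Fin 2 ⊕ Fin 1) ℂ) (Sum.inl 0) (Sum.inr 0) = 0 := congrFun (congrFun h12 0) 0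
    have hW12 : (W : Matrix (Fin 2 ⊕ Fin 1) (Fin 2 ⊕ Fin 1) ℂ) (Sum.inl 1) (Sum.inr 0) = 0 := congrFun (congrFun h12 1) 0
    have hbr : ∀ a : Fin 2, ((⁅W, X⁆ : G21.lie) : Matrix (Fin 2 ⊕ Fin 1) (Fin 2 ⊕ Fin 1) ℂ) (Sum.inl a) (Sum.inr 0) =
        (W : Matrix (Fin 2 ⊕ Fin 1) (Fin 2 ⊕ Fin 1) ℂ) (Sum.inl a) (Sum.inl 0) *
            (X : Matrix (Fin 2 ⊕ Fin 1) (Fin 2 ⊕ Fin 1) ℂ) (Sum.inl 0) (Sum.inr 0) +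
          (W : Matrix (Fin 2 ⊕ Fin 1) (Fin 2 ⊕ Fin 1) ℂ) (Sum.inl a) (Sum.inl 1) *
            (X : Matrix (Fin 2 ⊕ Fin 1) (Fin 2 ⊕ Fin 1) ℂ) (Sum.inl 1) (Sum.inr 0) -
          (X : Matrix (Fin 2 ⊕ Fin 1) (Fin 2 ⊕ Fin 1) ℂ) (Sum.inl a) (Sum.inr 0) *
            (W : Matrix (Fin 2 ⊕ Fin 1) (Fin 2 ⊕ Fin 1) ℂ) (Sum.inr 0) (Sum.inr 0) := by
      intro a
      rw [LieSubalgebra.coe_bracket, Ring.lie_def, Matrix.sub_apply, Matrix.mul_apply, Matrix.mul_apply,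
        Fintype.sum_sum_type, Fintype.sum_sum_type, Fin.sum_univ_two, Fin.sum_univ_two, Fin.sum_univ_one,
        Fin.sum_univ_one]
      fin_cases a
      · simp only [Fin.zero_eta, hW02, hW12, mul_zero, zero_mul, add_zero, zero_add]
      · simp only [Fin.mk_one, hW02, hW12, mul_zero, zero_mul, add_zero, zero_add]
    rw [phi_apply, phi_apply, hbr 0, hbr 1, kovLie_of_mem_kInLie ladderPlus.ρ W hW]
    simp only [LinearMap.add_apply, LinearMap.smul_apply, map_sub, map_smul, E00_vec_one, E00_vec_two, E11_vec_one,
      E11_vec_two, E22_vec, E01_vec_one, E01_vec_two, E10_vec_one, E10_vec_two, smul_zero, smul_neg]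
    module
  · -- (5) `z₀`-weight `I`
    intro X
    rw [phi_apply, kovLie_upqZ0]
    simp only [LinearMap.smul_apply, LinearMap.add_apply, map_sub, map_smul, E00_vec_one, E00_vec_two, E11_vec_one,
      E11_vec_two, add_zero, zero_add, Int.cast_one, one_mul]
    module
  · -- (6) `𝔭⁻`-nullity
    intro X s
    rw [kovLie_upqPBasis, kovLie_lie_upqZ0_upqPBasis, phi_apply]
    simp only [LinearMap.add_apply, LinearMap.smul_apply, E2a_phi, smul_zero, add_zero, Int.cast_one, one_mul, smul_smul,
      ← add_smul]
    rw [show upqPCoeff s.2 + Complex.I * (Complex.I * upqPCoeff s.2) = 0 by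
      rw [← mul_assoc, Complex.I_mul_I]; ring, zero_smul]

end Summit.HodgeConjecture.HodgeConjecture.Cruxes.H413.F0P3bStubW4ValueMap
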